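import Literature.GroupTheory.CombinatorialGroupTheory.SchreierIndexTwo
import Literature.Topology.FourManifolds.GroupTrisections
import Mathlib.Tactic.Group
import HarnessLib

/-!
# The rank-three free group `F⟨c, a, b⟩` inside `F⟨p, q⟩`: `c ↦ [p,q]`, `a ↦ q`, `b ↦ p²`

Topic `Literature/GroupTheory/CombinatorialGroupTheory`; theorems only.  The kernel `N` of the
parity homomorphism `F⟨p, q⟩ → ℤ/2`, `p ↦ 1`, `q ↦ 0`, is free on the Schreier basis
`{q, p², p q p⁻¹}` (Lyndon–Schupp I Prop. 4.8 / Reidemeister–Schreier; the tree's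
`SchreierIndexTwo.lean`, abc-iut-L5-t14), and `{[p,q], q, p²}` is obtained from it by a Nielsen
transformation.  Hence the homomorphism
`γ : F⟨c, a, b⟩ → F⟨p, q⟩`, `c ↦ [p, q] = p q p⁻¹ q⁻¹`, `a ↦ q`, `b ↦ p²`
is **injective** (`handleHom_injective`) — geometrically, the twice-punctured torus double-covers
the once-punctured torus with both boundary curves of degree one.  It is the map attaching a new
handle in the genus induction for the residual freeness of surface groups (G. Baumslag 1962,
Thm. 1): note `γ(c · [a, b]) = p · [p,q]⁻¹ · p⁻¹` (`handleHom_boundary`).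

Conventions: `F⟨p,q⟩ = FreeGroup Bool`, `p = of true`, `q = of false`;
`F⟨c,a,b⟩ = FreeGroup (Option (surfaceGen 1))`, `c = of none`, `a = of (some (0,false))`,
`b = of (some (0,true))`.

## References

* R. C. Lyndon, P. E. Schupp, *Combinatorial Group Theory*, Springer (1977); Classics in
  Mathematics (2001), Ch. I Prop. 4.8. [LyndonSchupp2001]
* G. Baumslag, *On generalised free products*, Math. Z. 78 (1962), §4. [Baumslag1962]
-/

namespace Literature.GroupTheory.CombinatorialGroupTheory

open Literature.Topology.FourManifolds

/-- The handle-attaching homomorphism `γ : F⟨c,a,b⟩ → F⟨p,q⟩`, `c ↦ [p,q]`, `a ↦ q`, `b ↦ p²`,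
written as a `FreeGroup.lift` (no definition is introduced). -/
local notation3 "γ" => (FreeGroup.lift fun o : Option (surfaceGen 1) =>
  Option.elim o (FreeGroup.of true * FreeGroup.of false * (FreeGroup.of true)⁻¹ * (FreeGroup.of false)⁻¹)
    (fun x => bif x.2 then FreeGroup.of true * FreeGroup.of true else FreeGroup.of false) : FreeGroup (Option (surfaceGen 1)) →* FreeGroup Bool)

/-! ### The Schreier data of the index-two kernel `p ↦ 1, q ↦ 0` -/

-- parity of the letters, the Schreier transversal `{1, p}`, the basis index type and evaluation
local notation3 "par" => (fun b : Bool => bif b then (1 : ZMod 2) else 0)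

local notation3 "Y₂" => {y : Multiplicative (ZMod 2) × Bool // y ≠ (1, true)}

set_option quotPrecheck false in
local notation3 "sec" => fun (r : Multiplicative (ZMod 2)) =>
  (if r = 1 then (1 : FreeGroup Bool) else FreeGroup.of true)

set_option quotPrecheck false in
local notation3 "ev" => (FreeGroup.lift fun y : Y₂ =>
  sec (Prod.fst (Subtype.val y)) * FreeGroup.of (Prod.snd (Subtype.val y)) *
    (sec (Prod.fst (Subtype.val y) * Multiplicative.ofAdd (par (Prod.snd (Subtype.val y)))))⁻¹)

set_option quotPrecheck false in
local notation3 "Ψ₂" => (FreeGroup.lift fun i : Bool =>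
  (RegularWreathProduct.mk (fun r => (if h : (r, i) = ((1 : Multiplicative (ZMod 2)), true)
      then (1 : FreeGroup Y₂) else FreeGroup.of (⟨(r, i), h⟩ : Y₂)))
    (Multiplicative.ofAdd (par i)) : FreeGroup Y₂ ≀ᵣ Multiplicative (ZMod 2)))

/-- The Schreier generator `q ↦ (0, q)` is an admissible index. [folklore] -/
private theorem y_ne₁ : ((1 : Multiplicative (ZMod 2)), false) ≠ (1, true) := by decide

/-- The Schreier generator `p² ↦ (1, p)` is an admissible index. [folklore] -/
private theorem y_ne₂ : ((Multiplicative.ofAdd (1 : ZMod 2)), true) ≠ (1, true) := by decide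

/-- The Schreier generator `p q p⁻¹ ↦ (1, q)` is an admissible index. [folklore] -/
private theorem y_ne₃ : ((Multiplicative.ofAdd (1 : ZMod 2)), false) ≠ (1, true) := by decide

/-- **Evaluation of the Schreier basis is injective** (Reidemeister–Schreier rewriting inverts
it: the tree's `left_psi_ev`). [cite: LyndonSchupp2001, Ch. I Prop. 4.8] -/
theorem ev_indexTwo_injective : Function.Injective ev := by
  intro w₁ w₂ h
  have e1 := SchreierIndexTwo.left_psi_ev (c := par) (x₁ := true) rfl w₁
  have e2 := SchreierIndexTwo.left_psi_ev (c := par) (x₁ := true) rfl w₂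
  have : (Ψ₂ (ev w₁)).left 1 = (Ψ₂ (ev w₂)).left 1 := by rw [h]
  rw [e1, e2] at this
  exact this

/-! ### The handle homomorphism -/

/-- `γ` on the generators. [cite: Baumslag1962, §4] -/
theorem handleHom_of_none : γ (FreeGroup.of none) =
    FreeGroup.of true * FreeGroup.of false * (FreeGroup.of true)⁻¹ * (FreeGroup.of false)⁻¹ := by
  rw [FreeGroup.lift_apply_of]; rfl

/-- `γ(a) = q`. [cite: Baumslag1962, §4] -/
theorem handleHom_of_a : γ (FreeGroup.of (some ((0 : Fin 1), false))) = FreeGroup.of false := by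
  rw [FreeGroup.lift_apply_of]; rfl

/-- `γ(b) = p²`. [cite: Baumslag1962, §4] -/
theorem handleHom_of_b : γ (FreeGroup.of (some ((0 : Fin 1), true))) =
    FreeGroup.of true * FreeGroup.of true := by
  rw [FreeGroup.lift_apply_of]; rfl

/-- **`γ` is injective**: it factors as a Nielsen automorphism of `F(Y)` followed by the
(injective) evaluation of the Schreier basis. [cite: LyndonSchupp2001, Ch. I Prop. 4.8] -/
theorem handleHom_injective : Function.Injective γ := by
  -- θ : F⟨c,a,b⟩ → F(Y): c ↦ y₃ y₁⁻¹, a ↦ y₁, b ↦ y₂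
  let θ : FreeGroup (Option (surfaceGen 1)) →* FreeGroup Y₂ := FreeGroup.lift fun o =>
    Option.elim o (FreeGroup.of ⟨_, y_ne₃⟩ * (FreeGroup.of ⟨_, y_ne₁⟩)⁻¹)
      fun x => bif x.2 then FreeGroup.of ⟨_, y_ne₂⟩ else FreeGroup.of ⟨_, y_ne₁⟩
  -- a left inverse of θ
  let θ' : FreeGroup Y₂ →* FreeGroup (Option (surfaceGen 1)) := FreeGroup.lift fun y =>
    bif (Subtype.val y).2 then FreeGroup.of (some ((0 : Fin 1), true))
    else if (Subtype.val y).1 = 1 then FreeGroup.of (some ((0 : Fin 1), false))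
      else FreeGroup.of none * FreeGroup.of (some ((0 : Fin 1), false))
  have hθ : θ'.comp θ = MonoidHom.id _ := by
    refine FreeGroup.ext_hom _ _ fun o => ?_
    have h10 : (Multiplicative.ofAdd (1 : ZMod 2)) ≠ 1 := by decide
    rcases o with _ | ⟨i, _ | _⟩
    · simp [θ, θ', h10]
    · have hi : i = 0 := Subsingleton.elim _ _
      subst hi
      simp [θ, θ']
    · have hi : i = 0 := Subsingleton.elim _ _
      subst hi
      simp [θ, θ']
  have hθinj : Function.Injective θ := by
    intro x y hxy
    have := congrArg θ' hxy
    rwa [← MonoidHom.comp_apply, ← MonoidHom.comp_apply, hθ] at this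
  -- γ = ev ∘ θ
  have hfac : (γ) = (ev).comp θ := by
    have h10 : (Multiplicative.ofAdd (1 : ZMod 2)) ≠ 1 := by decide
    have h11 : Multiplicative.ofAdd (1 : ZMod 2) * Multiplicative.ofAdd 1 = 1 := by decide
    refine FreeGroup.ext_hom _ _ fun o => ?_
    rcases o with _ | ⟨i, _ | _⟩
    · rw [MonoidHom.comp_apply]
      simp [θ, h10]
    · have hi : i = 0 := Subsingleton.elim _ _
      subst hi
      rw [MonoidHom.comp_apply]
      simp [θ]
    · have hi : i = 0 := Subsingleton.elim _ _
      subst hi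
      rw [MonoidHom.comp_apply]
      simp [θ, h10, h11]
  rw [hfac, MonoidHom.coe_comp]
  exact ev_indexTwo_injective.comp hθinj

/-- **The boundary of the attached handle**: `γ(c) · [γ(a), γ(b)] = p · [p,q]⁻¹ · p⁻¹`, so the
boundary word `c [a, b]` of the new handle goes to a conjugate of `[p,q]⁻¹`.
[cite: Baumslag1962, §4] -/
theorem handleHom_boundary :
    γ (FreeGroup.of none * (FreeGroup.of (some ((0 : Fin 1), false)) * FreeGroup.of (some ((0 : Fin 1), true)) *
      (FreeGroup.of (some ((0 : Fin 1), false)))⁻¹ * (FreeGroup.of (some ((0 : Fin 1), true)))⁻¹)) =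
    FreeGroup.of true * (FreeGroup.of true * FreeGroup.of false * (FreeGroup.of true)⁻¹ *
      (FreeGroup.of false)⁻¹)⁻¹ * (FreeGroup.of true)⁻¹ := by
  simp only [map_mul, map_inv, handleHom_of_none, handleHom_of_a, handleHom_of_b]
  group

end Literature.GroupTheory.CombinatorialGroupTheory
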